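import Summits.BirchSwinnertonDyer.BirchSwinnertonDyer.Theorems.KimAtThreeKolyvaginDeepUpperRung
import Literature.NumberTheory.EllipticCurves.SkinnerUrban2014.PAdicUnitPeriodRatioAnyPrimeProofs
import HarnessLib

/-!
# Route `KimAtThreeKolyvagin` (rung W2), crux `DeepUpperAtThree`: the potentially-good half REDUCED to a
# statement about Kurihara numbers alone

An alternative layer-2 decomposition of the potentially-good stratum of the crux `DeepUpperAtThree`
(item `stmt-BirchSwinnertonDyer-19076`; the Theses' own plan is LocalLatticeAtThree → DictionaryD).
The Tamagawa-EXACT reading of Kato's Euler-system bound, IN PRINT (tree fact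
`Kato2004.rankZero_padicValNat_sha_add_padicValNat_tamagawa_le_of_additive_potGood_of_imageContainsSL2`:
Kato Thm. 14.5 (3) + Prop. 14.16 (2) + §14.8 with Greenberg's form of Cassels' theorem), already gives
`ord₃ #Ш(E/ℚ)(3) + v₃(∏ c_ℓ) ≤ ∂⁽⁰⁾(δ̃)` in the crux's currency
(`KimAtThreeKolyvaginDeepUpperRung.sha_add_tamagawa_le_kuriharaPartial_zero_of_kato2004TamagawaExact`).
Hence the WHOLE Ш-side of the crux is in print on that stratum, and what remains is a statement in
which `Ш` does not occur:

  (DeepDefect ≤ Tamagawa)  `∂^{(∞)}_{deep}(δ̃) ≤ v₃(∏_ℓ c_ℓ(E))`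

— the "≤" half, in the deep-limit form, of Kim's Tamagawa-defect prediction `∂^{(∞)}(δ̃) = Σ_ℓ v_p(c_ℓ)`
(AJM 148 Conj. 1.10), i.e. "Kurihara numbers at arbitrarily deep cyclic levels are no more
`3`-divisible than the Tamagawa product". It is OPEN (it is what Mazur–Rubin's Thm. 5.2.12 for Kato's
Kolyvagin system at `p = 3` plus the dictionary `x_n ↔ δ̃_n` deliver in the cell memo
`kim3/KIM3-PROOF.md` §4–§5, granted `3`-part BSD; sharper than the crux by Kato's index `μ`), and it is
carried here as an inline HYPOTHESIS, not asserted. The theorem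
`deepUpperAtThree_potGood_of_deepDefectLeTamagawa_of_kato2004TamagawaExact` composes the two into the
crux's exact conclusion (`∂^{(∞)}_{deep} = d ∈ ℕ` and `ord₃ #Ш(3) + d ≤ ∂⁽⁰⁾`) on the potentially-good
stratum with the period transfer `hper`. The converse bookkeeping
`deepDefect_le_of_deepUpperAtThree_of_lowerHalf` records that (DeepDefect ≤ Tamagawa) follows from
the crux together with the `∂`-currency LOWER half `∂⁽⁰⁾(δ̃) ≤ ord₃ #Ш(3) + v₃(∏ c_ℓ)` (3-part BSD's
other inequality on these rows) — so the hypothesis is BSD-consistent and not stronger than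
"crux ∧ BSD₃-lower". Finally `deepUpperAtThree_truncation_potGood_of_kato2004ManinFree_of_maninConstantOptimal`
re-reads the landed Manin-free rung with the period-transfer binder `hper` DISCHARGED CLASS-WIDE under
the tower: `E[3]` irreducible ⇒ an isogeny of degree prime to `3` to the strong Weil curve, whence
`Ω(W) = u · Ω⁺_f`, `|u|₃ = 1`, granted only that the Manin constant `c₀` of the lattice-optimal datum is
prime to `3` (tree theorem `SkinnerUrban2014.exists_unit_mul_plusPeriod_of_irreducible_anyPrime`,
Greenberg–Vatsal 2000 Rem. 3.4) — the (P)-binder of REF-kim3 C10-R in its weakest, isogeny-class form.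
Nothing is asserted; the crux stays open.
[cite: GreenbergVatsal2000, §3, Remark 3.4] [cite: Kato2004Asterisque, Thm. 14.5 (3) (p. 236), Prop. 14.16 (2) (p. 244), §14.8 (p. 238)]
[cite: GreenbergLNM1716, Prop. 4.13, §4] [cite: Kim2022StructureSelmer, Conj. 1.10 (PDF p. 8), §1.5.1 (PDF p. 7)]
[cite: MazurRubin2004, Thm. 5.2.12] [cite: Kim2025RefinedTNC, Thm 1.1]
-/

set_option autoImplicit false
-- the Theorems namespace of a single-conjunct summit repeats the summit name by design (D-0017)
set_option linter.dupNamespace false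

noncomputable section

open scoped MatrixGroups ModularForm Classical

open CongruenceSubgroup WeierstrassCurve Literature.NumberTheory.EllipticCurves
  Literature.NumberTheory.EllipticCurves.ModularForms

namespace Summit.BirchSwinnertonDyer.BirchSwinnertonDyer.Theorems.KimAtThreeKolyvaginDeepUpperPotGoodReduction

open Summit.BirchSwinnertonDyer.Rank1Residual.Additive
open Summit.BirchSwinnertonDyer.BirchSwinnertonDyer.Theses.KimAtThreeKolyvagin
open Summit.BirchSwinnertonDyer.BirchSwinnertonDyer.Theorems.KimAtThreeKolyvaginDeepUpperRung

/-- **`DeepUpperAtThree` on the potentially-good stratum from PRINT plus the Kurihara-side defect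
bound.** Hypotheses: `hKato` = the Tamagawa-exact reading of Kato Thm. 14.5 (3) / Prop. 14.16 (2)
(named fact); `hDefect` = (DeepDefect ≤ Tamagawa) on the stratum, INLINE and OPEN:
`∂^{(∞)}_{deep}(δ̃) ≤ v₃(∏ c_ℓ)`. Conclusion: for `W/ℚ` globally minimal with the `3`-adic tower onto,
`Ш(E/ℚ)` finite, `f` the newform (crux binders), `3` additive potentially good and the period transfer
`Ω(W) = u · Ω⁺_f` (`|u|₃ = 1`): `∂^{(∞)}_{deep}(δ̃) = d ∈ ℕ` and `ord₃ #Ш(E/ℚ)(3) + d ≤ ∂⁽⁰⁾(δ̃)` — the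
crux's exact conclusion. [cite: Kato2004Asterisque, Thm. 14.5 (3) (p. 236), Prop. 14.16 (2) (p. 244), §14.8 (p. 238)]
[cite: Kim2022StructureSelmer, Conj. 1.10 (PDF p. 8)] -/
theorem deepUpperAtThree_potGood_of_deepDefectLeTamagawa_of_kato2004TamagawaExact
    (hKato : Kato2004.rankZero_padicValNat_sha_add_padicValNat_tamagawa_le_of_additive_potGood_of_imageContainsSL2)
    (hDefect : ∀ (W : WeierstrassCurve ℚ) [W.IsElliptic] [W.IsGloballyMinimal],
      (∀ n : ℕ, W.HasSurjectiveModNGaloisRep (3 ^ n : ℕ)) →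
      Finite W.sha →
      ∀ {N : ℕ} [NeZero N] (f : CuspForm (Gamma0 N) 2), IsNewformOf W f →
      (∀ r : ℚ, ratPlusSymbol f r ≠ 0 → 0 ≤ padicValRat 3 (ratPlusSymbol f r)) →
      kuriharaVanishingOrder W 3 f = 0 →
      ¬ W.HasGoodReductionAtPrime 3 → ¬ W.HasMultiplicativeReductionAtPrime 3 →
      0 ≤ padicValRat 3 W.j →
        kuriharaPartialDeepInfty W 3 f ≤ ((padicValNat 3 W.tamagawaProduct : ℕ) : ℕ∞)) :
    ∀ (W : WeierstrassCurve ℚ) [W.IsElliptic] [W.IsGloballyMinimal],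
      (∀ n : ℕ, W.HasSurjectiveModNGaloisRep (3 ^ n : ℕ)) →
      Finite W.sha →
      ∀ {N : ℕ} [NeZero N] (f : CuspForm (Gamma0 N) 2), IsNewformOf W f →
      (∀ r : ℚ, ratPlusSymbol f r ≠ 0 → 0 ≤ padicValRat 3 (ratPlusSymbol f r)) →
      kuriharaVanishingOrder W 3 f = 0 →
      ¬ W.HasGoodReductionAtPrime 3 → ¬ W.HasMultiplicativeReductionAtPrime 3 →
      0 ≤ padicValRat 3 W.j →
      (∃ u : ℚ, ‖(u : ℚ_[3])‖ = 1 ∧ W.realPeriodRat = u * plusPeriod f) →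
        ∃ d : ℕ, kuriharaPartialDeepInfty W 3 f = d ∧
          ((padicValNat 3 (Nat.card (AddCommGroup.primaryComponent W.sha 3)) + d : ℕ) : ℕ∞) ≤
            kuriharaPartial W 3 f 0 := by
  intro W _ _ htower hfin N _ f hf hint hord hgood hmult hpot hper
  have hD := hDefect W htower hfin f hf hint hord hgood hmult hpot
  obtain ⟨d, hd, hdle⟩ := ENat.le_coe_iff.mp hD
  refine ⟨d, hd, ?_⟩
  have hK := sha_add_tamagawa_le_kuriharaPartial_zero_of_kato2004TamagawaExact hKato W htower hfin f hf hord
    hgood hmult hpot hper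
  refine le_trans ?_ hK
  exact_mod_cast Nat.add_le_add_left hdle _

/-- **BSD-consistency of the hypothesis**: (DeepDefect ≤ Tamagawa) at `(W, f)` follows from the crux's
conclusion at `(W, f)` together with the `∂`-currency LOWER half `∂⁽⁰⁾(δ̃) ≤ ord₃ #Ш(3) + v₃(∏ c_ℓ)`
(pure `ℕ∞` bookkeeping: `ord₃ #Ш + d ≤ ∂⁽⁰⁾ ≤ ord₃ #Ш + v₃(∏ c_ℓ)`). [cite: Kim2022StructureSelmer, Conj. 1.10 (PDF p. 8)] -/
theorem deepDefect_le_of_deepUpperAtThree_of_lowerHalf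
    (W : WeierstrassCurve ℚ) [W.IsGloballyMinimal] {N : ℕ} (f : CuspForm (Gamma0 N) 2) {d : ℕ}
    (hd : kuriharaPartialDeepInfty W 3 f = d)
    (hU : ((padicValNat 3 (Nat.card (AddCommGroup.primaryComponent W.sha 3)) + d : ℕ) : ℕ∞) ≤
      kuriharaPartial W 3 f 0)
    (hL : kuriharaPartial W 3 f 0 ≤
      ((padicValNat 3 (Nat.card (AddCommGroup.primaryComponent W.sha 3)) +
        padicValNat 3 W.tamagawaProduct : ℕ) : ℕ∞)) :
    kuriharaPartialDeepInfty W 3 f ≤ ((padicValNat 3 W.tamagawaProduct : ℕ) : ℕ∞) := by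
  rw [hd]
  have h : padicValNat 3 (Nat.card (AddCommGroup.primaryComponent W.sha 3)) + d ≤
      padicValNat 3 (Nat.card (AddCommGroup.primaryComponent W.sha 3)) +
        padicValNat 3 W.tamagawaProduct := by
    exact_mod_cast hU.trans hL
  exact_mod_cast Nat.le_of_add_le_add_left h

/-! ### The period binder discharged class-wide under the tower (Greenberg–Vatsal Rem. 3.4) -/

/-- **The Manin-free rung with `hper` discharged for the whole isogeny class**: for `W/ℚ` globally
minimal with the `3`-adic tower onto (so `E[3]` is irreducible and `W` is isogenous to the strong Weil
curve by an isogeny of degree prime to `3`), `Ш(E/ℚ)` finite, `f` the newform, `3` additive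
potentially good, and — the only non-intrinsic datum — the Manin constant of every lattice-optimal
datum at the level of `f` prime to `3`: `ord₃ #Ш(E/ℚ)(3) ≤ ∂⁽⁰⁾(δ̃)`, from the named fact `hKato`
(Manin-free `c₃`-sharpened Kato reading) via
`KimAtThreeKolyvaginDeepUpperRung.deepUpperAtThree_truncation_potGood_of_kato2004ManinFree` and
`SkinnerUrban2014.exists_unit_mul_plusPeriod_of_irreducible_anyPrime`.
[cite: GreenbergVatsal2000, §3, Remark 3.4] [cite: Kato2004Asterisque, Thm. 14.5 (3) (p. 236), Prop. 14.16 (2) (p. 244)] -/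
theorem deepUpperAtThree_truncation_potGood_of_kato2004ManinFree_of_maninConstantOptimal
    (hKato : Kato2004.rankZero_padicValNat_sha_le_sub_localTamagawa_of_additive_potGood_of_imageContainsSL2_maninFree) :
    ∀ (W : WeierstrassCurve ℚ) [W.IsElliptic] [W.IsGloballyMinimal],
      (∀ n : ℕ, W.HasSurjectiveModNGaloisRep (3 ^ n : ℕ)) →
      Finite W.sha →
      ∀ {N : ℕ} [NeZero N] (f : CuspForm (Gamma0 N) 2), IsNewformOf W f →
      (∀ r : ℚ, ratPlusSymbol f r ≠ 0 → 0 ≤ padicValRat 3 (ratPlusSymbol f r)) →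
      kuriharaVanishingOrder W 3 f = 0 →
      ¬ W.HasGoodReductionAtPrime 3 → ¬ W.HasMultiplicativeReductionAtPrime 3 →
      0 ≤ padicValRat 3 W.j →
      (∀ (W₀ : WeierstrassCurve ℚ) [W₀.IsElliptic] [W₀.IsGloballyMinimal]
        (D₀ : ModularParametrizationData W₀ N), D₀.f = f →
        (∀ z ∈ D₀.L.lattice, ∃ w ∈ periodLattice D₀.f, z = D₀.c * w) → ¬ (3 : ℤ) ∣ D₀.maninConstant) →
        ((padicValNat 3 (Nat.card (AddCommGroup.primaryComponent W.sha 3)) : ℕ) : ℕ∞) ≤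
          kuriharaPartial W 3 f 0 := by
  intro W _ _ htower hfin N _ f hf hint hord hgood hmult hpot hc
  have hirr : W.HasIrreducibleModPGaloisRep 3 :=
    hasIrreducibleModPGaloisRep_of_hasSurjectiveModNGaloisRep W 3 (by simpa using htower 1)
  have hper := SkinnerUrban2014.exists_unit_mul_plusPeriod_of_irreducible_anyPrime W 3 hirr f hf
    (fun W₀ _ _ D₀ hD₀ hopt => hc W₀ D₀ hD₀ hopt)
  exact deepUpperAtThree_truncation_potGood_of_kato2004ManinFree hKato W htower hfin f hf hint hord hgood
    hmult hpot hper

end Summit.BirchSwinnertonDyer.BirchSwinnertonDyer.Theorems.KimAtThreeKolyvaginDeepUpperPotGoodReduction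

end
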